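import Summits.AtomisticToContinuum.Crystallization.Theorems.GscTwinLoopSurgeryGscHingeGlueCore
import Summits.AtomisticToContinuum.Crystallization.Theorems.GscTwinLoopSurgeryGscHingeGlueFinite
import Summits.AtomisticToContinuum.Crystallization.Theorems.GscTwinLoopSurgeryGscHingeGlueParams

/-!
# Route `GscTwinLoopSurgery`: the glue `GscHingeGlue` (item stmt-AtomisticToContinuum-14087)

Route decl `Summit.AtomisticToContinuum.Crystallization.Theses.GscTwinLoopSurgery.GscHingeGlue`:

  `LocalLimitStable → LayeredWindows → TwinLoopLemma → HcpPerfectWindows → LjRegistryDomination →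
   NoFoam → GroundStatesChargePeriodic`.

Assembly of Lemma A (`exists_good_particle`, infinite volume: every `r₀`-dense local limit has
good hcp windows at particles), Lemma B (`eventually_density_good`, finite `N`: `NoFoam` and
compactness give a positive density of particles good for SOME `hcpStacking a h`,
`(a, h) ∈ B′`) and Lemma C (`exists_params_of_cover`: one `(a, h)` for all scales, frequently in
`N`); the charged periodic configuration is `Q = hcpPeriodicConfiguration a h`
(`hcpPeriodicConfiguration_points`). [folklore]
-/

noncomputable section

open scoped BigOperators Topology
open Filter Set Metric

namespace Summit.AtomisticToContinuum.Crystallization.Theorems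

open Literature.MathematicalPhysics.StatisticalMechanics
open Summit.AtomisticToContinuum.Crystallization.Theses.GscTwinLoopSurgery
open Summit.AtomisticToContinuum.Crystallization.Theorems.GscHingeGlue

/-- Monotonicity of `Nat.card` of subtypes of `Fin N` under implication. [folklore] -/
theorem GscHingeGlue.natCard_subtype_mono {N : ℕ} {P Q : Fin N → Prop} (h : ∀ i, P i → Q i) :
    Nat.card {i : Fin N // P i} ≤ Nat.card {i : Fin N // Q i} :=
  Nat.card_le_card_of_injective (fun j : {i : Fin N // P i} => (⟨j.1, h j.1 j.2⟩ : {i : Fin N // Q i}))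
    fun a b hab => Subtype.ext (by simpa using congrArg Subtype.val hab)

/-- **`GscHingeGlue`** (item stmt-AtomisticToContinuum-14087): the five cruxes of route
`GscTwinLoopSurgery` and `LocalLimitStable` imply the finite-`N` hinge
`GroundStatesChargePeriodic` — every sequence of Lennard-Jones ground states charges ONE
periodic configuration (an hcp stacking `hcpPeriodicConfiguration a h`, `(a, h) ∈ B′`) with a
positive density of good particles at every scale, for infinitely many `N`. [folklore] -/
theorem gscHingeGlue_proof :
    Summit.AtomisticToContinuum.Crystallization.Theses.GscTwinLoopSurgery.GscHingeGlue := by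
  intro hLLS hLW hTLL hHPW hLRD hNF x hx
  obtain ⟨r₀, hr₀, hfoam⟩ := hNF
  -- Lemma A
  have hcore : ∀ X : Set (EuclideanSpace ℝ (Fin 3)), IsLocalLimitOfGroundStates lennardJones 3 X →
      (∀ c, ∃ q ∈ X, dist q c ≤ r₀) → ∀ R ε : ℝ, 0 ≤ R → 0 < ε → ε ≤ 1 →
      ∃ p ∈ X, ∃ a h : ℝ, (191 / 200 ≤ a ∧ a ≤ 197 / 200 ∧ 81 / 100 * a ≤ h ∧ h ≤ 329 / 400 * a) ∧
        ∃ (A : EuclideanSpace ℝ (Fin 3) →ₗᵢ[ℝ] EuclideanSpace ℝ (Fin 3)) (q : EuclideanSpace ℝ (Fin 3)),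
          q ∈ hcpStacking a h ∧ BallMatch ε R p X ((fun s => p + A (s - q)) '' hcpStacking a h) :=
    fun X hX hdense R ε hR hε hε1 =>
      exists_good_particle hLLS hLW hTLL hHPW hLRD hX hr₀ hdense hR hε hε1
  -- Lemma B, at every scale (tolerances above `1` are weaker than tolerance `1`)
  have hB : ∀ R ε : ℝ, 0 < R → 0 < ε → ∃ ρ : ℝ, 0 < ρ ∧ ∀ᶠ N : ℕ in atTop,
      ρ * (N : ℝ) ≤ (Nat.card {i : Fin N // ∃ a h : ℝ,
        (191 / 200 ≤ a ∧ a ≤ 197 / 200 ∧ 81 / 100 * a ≤ h ∧ h ≤ 329 / 400 * a) ∧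
        ∃ A : EuclideanSpace ℝ (Fin 3) →ₗᵢ[ℝ] EuclideanSpace ℝ (Fin 3), ∃ q ∈ hcpStacking a h,
          (∀ s ∈ hcpStacking a h, dist s q ≤ R → ∃ j, dist (x N j) (x N i + A (s - q)) ≤ ε) ∧
          (∀ j, dist (x N j) (x N i) ≤ R →
            ∃ s ∈ hcpStacking a h, dist (x N j) (x N i + A (s - q)) ≤ ε)} : ℝ) := by
    intro R ε hR hε
    obtain ⟨ρ, hρ, hev⟩ := eventually_density_good hcore hfoam x hx hR.le
      (lt_min hε one_pos) (min_le_right ε 1)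
    refine ⟨ρ, hρ, hev.mono fun N hN => hN.trans ?_⟩
    exact_mod_cast GscHingeGlue.natCard_subtype_mono fun i hi => by
      obtain ⟨a, h, hab, hgood⟩ := hi
      exact ⟨a, h, hab, good_mono (x N) i le_rfl (min_le_left ε 1) hgood⟩
  -- Lemma C
  obtain ⟨a, h, hab, hC⟩ := exists_params_of_cover x hB
  have ha : a ≠ 0 := by linarith [hab.1]
  have hh : h ≠ 0 := by nlinarith [hab.1, hab.2.2.1]
  refine ⟨hcpPeriodicConfiguration ha hh, fun R ε hR hε => ?_⟩
  rw [hcpPeriodicConfiguration_points]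
  exact hC R ε hR hε

end Summit.AtomisticToContinuum.Crystallization.Theorems

end
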